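import Summits.KontsevichZagierPeriods.Zeta5Search.TwoTaleOmega.OmegaRegion
import Summits.KontsevichZagierPeriods.Zeta5Search.Certificates.TwoTaleOmegaAssembly

/-!
# (bmiss)@Ω — bridge between cert-2's Ω-induction skeleton and the hinge forms (cell `pub-zeta5`, cert-1 gen 4)

HONEST FRAMING: systematic search; recurrence certificates; no irrationality claim unless certified. Pure bookkeeping; no named
fact, no `sorry`.

cert-2's combinatorial layer (`Certificates/TwoTaleOmegaInduction`, `…Assembly`, `…AefTable.eq_on_Omega_all`) runs fam-tele's
Ω-induction for ABSTRACT functions `I_L, I_R : (Fin 5 → ℤ) → F` with the kernel coefficient tables `coef cAEFtab δ p₀ k`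
(`tabAt (tab<D> k) p₀ = spvalC c<D>k` at the INTEGER letters); its remaining hypotheses `hL/hR` are the per-direction step relations.
fam-tele's hinge (`TwoTaleOmega/OmegaForms`) and the per-direction instances (`TwoTaleOmega/StepB*`, …) live on the structure
`TwoTaleOmega.Pt` with RATIONAL coefficient values. This file is the dictionary:
* `ofVec q = ⟨q 0, q 1, q 2, q 3, q 4⟩`, `Omega_ofVec : q ∈ TwoTaleTelescope.Omega → (ofVec q).Omega` (the two spellings of Ω agree);
* `ofVec (q + k • dirB) = (ofVec q).addB k` and the analogues for `dirG, dirE, dirF, dirA`;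
* `spvalC_intCast : ((spvalC dd a b e f g : ℤ) : ℚ) = spvalC dd ↑a ↑b ↑e ↑f ↑g` (integer tables evaluated then cast), hence
  `tabAt_cast`.
With these, a direction's `rec_<d>` on `U1/U0` becomes literally the `δ = dir<D>` case of `hL`/`hR` (see `StepB.hstep_b`).
-/

noncomputable section

open Finset
open Summit.KontsevichZagierPeriods.Zeta5Search.Certificates.TwoTaleTelescope

namespace Summit.KontsevichZagierPeriods.Zeta5Search.TwoTaleOmega

/-! ### Casting the integer coefficient tables -/

/-- `spval` commutes with the cast `ℤ → ℚ`. -/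
theorem spval_intCast (d : List (ℤ × ℕ × ℕ × ℕ × ℕ × ℕ)) (a b e f g : ℤ) :
    ((spval d a b e f g : ℤ) : ℚ) = spval d (a : ℚ) b e f g := by
  induction d with
  | nil => simp
  | cons x d ih => rw [spval_cons, spval_cons, Int.cast_add, ih]; push_cast; ring

/-- `spvalN` commutes with the cast `ℤ → ℚ`. -/
theorem spvalN_intCast (d : List ℕ) (a b e f g : ℤ) : ((spvalN d a b e f g : ℤ) : ℚ) = spvalN d (a : ℚ) b e f g := by
  unfold spvalN; exact spval_intCast _ a b e f g

/-- `spvalC` commutes with the cast `ℤ → ℚ`: an integer table evaluated at integer letters, then cast, is the table evaluated at the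
cast letters. -/
theorem spvalC_intCast (dd : List (List ℕ)) (a b e f g : ℤ) :
    ((spvalC dd a b e f g : ℤ) : ℚ) = spvalC dd (a : ℚ) b e f g := by
  unfold spvalC
  induction dd with
  | nil => simp
  | cons d dd ih => rw [List.map_cons, List.map_cons, List.sum_cons, List.sum_cons, Int.cast_add, ih, spvalN_intCast]

/-! ### The two spellings of the points and of Ω -/

/-- From cert-2's vectors `Fin 5 → ℤ` (`q 0 = a, …, q 4 = g`) to fam-tele's structure `Pt`. -/
def ofVec (q : Certificates.TwoTaleTelescope.Pt) : Pt := ⟨q 0, q 1, q 2, q 3, q 4⟩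

/-- Coordinates of `ofVec`. -/
@[simp] theorem ofVec_a (q : Certificates.TwoTaleTelescope.Pt) : (ofVec q).a = q 0 := rfl
/-- Coordinates of `ofVec`. -/
@[simp] theorem ofVec_b (q : Certificates.TwoTaleTelescope.Pt) : (ofVec q).b = q 1 := rfl
/-- Coordinates of `ofVec`. -/
@[simp] theorem ofVec_e (q : Certificates.TwoTaleTelescope.Pt) : (ofVec q).e = q 2 := rfl
/-- Coordinates of `ofVec`. -/
@[simp] theorem ofVec_f (q : Certificates.TwoTaleTelescope.Pt) : (ofVec q).f = q 3 := rfl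
/-- Coordinates of `ofVec`. -/
@[simp] theorem ofVec_g (q : Certificates.TwoTaleTelescope.Pt) : (ofVec q).g = q 4 := rfl

/-- cert-2's `Omega` membership gives fam-tele's `Pt.Omega` (the two lists of inequalities are equivalent spellings of PROOF.md §0). -/
theorem Omega_ofVec {q : Certificates.TwoTaleTelescope.Pt} (h : q ∈ Certificates.TwoTaleTelescope.Omega) : (ofVec q).Omega := by
  obtain ⟨h0, h1, h2, h3, h4, h5, h6, h7, h8, h9, h10, h11, h12, h13, h14⟩ := mem_Omega.mp h
  refine ⟨?_, ?_, ?_, ?_, ?_, ?_, ?_, ?_, ?_⟩ <;> simp only [ofVec_a, ofVec_b, ofVec_e, ofVec_f, ofVec_g] <;> omega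

/-- Conversely, fam-tele's `Pt.Omega` gives cert-2's `Omega` membership. -/
theorem mem_Omega_ofVec {q : Certificates.TwoTaleTelescope.Pt} (h : (ofVec q).Omega) : q ∈ Certificates.TwoTaleTelescope.Omega := by
  obtain ⟨h1, h2, h3, h4, h5, h6, h7, h8, h9⟩ := h
  simp only [ofVec_a, ofVec_b, ofVec_e, ofVec_f, ofVec_g] at h1 h2 h3 h4 h5 h6 h7 h8 h9
  refine mem_Omega.mpr ⟨?_, ?_, ?_, ?_, ?_, ?_, ?_, ?_, ?_, ?_, ?_, ?_, ?_, ?_, ?_⟩ <;> omega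

/-- Moving along `dirB` is `addB`. -/
theorem ofVec_add_dirB (q : Certificates.TwoTaleTelescope.Pt) (k : ℤ) : ofVec (q + k • dirB) = (ofVec q).addB k := by
  simp [ofVec, Pt.addB, dirB]

/-- Moving along `dirG` is `addG`. -/
theorem ofVec_add_dirG (q : Certificates.TwoTaleTelescope.Pt) (k : ℤ) : ofVec (q + k • dirG) = (ofVec q).addG k := by
  simp [ofVec, Pt.addG, dirG]

/-- Moving along `dirE` is `addE`. -/
theorem ofVec_add_dirE (q : Certificates.TwoTaleTelescope.Pt) (k : ℤ) : ofVec (q + k • dirE) = (ofVec q).addE k := by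
  simp [ofVec, Pt.addE, dirE]

/-- Moving along `dirF` is `addF`. -/
theorem ofVec_add_dirF (q : Certificates.TwoTaleTelescope.Pt) (k : ℤ) : ofVec (q + k • dirF) = (ofVec q).addF k := by
  simp [ofVec, Pt.addF, dirF]

/-- Moving along `dirA` is `addA`. -/
theorem ofVec_add_dirA (q : Certificates.TwoTaleTelescope.Pt) (k : ℤ) : ofVec (q + k • dirA) = (ofVec q).addA k := by
  simp [ofVec, Pt.addA, dirA]

/-- cert-2's table value, cast to `ℚ`, is the table evaluated at the cast letters of `ofVec q`. -/
theorem tabAt_cast (c : List (List ℕ)) (q : Certificates.TwoTaleTelescope.Pt) :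
    ((tabAt c q : ℤ) : ℚ) = spvalC c ((ofVec q).a : ℚ) (ofVec q).b (ofVec q).e (ofVec q).f (ofVec q).g := by
  unfold tabAt; rw [spvalC_intCast]; rfl

end Summit.KontsevichZagierPeriods.Zeta5Search.TwoTaleOmega

end
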